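import Summits.RiemannHypothesis.RiemannHypothesis.Theorems.PfPersistenceEdgeLawCuspInteriorDefect
import Summits.RiemannHypothesis.RiemannHypothesis.Theorems.WeilGroundStateMarkovPartPositiveGroundStatePhase

/-!
# Edge law — (R3) is a property of the a.e. class; the representative form of the cusp modulus

Part of the pub-rhpf THEORY-2 programme (mechanism / rigidity of the Weil window bottom; no RH
claims). `IsWeilGroundState a u` only sees the a.e. class of `u`, while the cusp modulus
`HasCuspModulusWith a u C Ξ` is a pointwise statement about the representative. This file closes
the gap: the interior dilation defect `t_η`, the window defect form `D_a` and hence (R3)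
(`HasInteriorRegularDefect`) only depend on the a.e. class, so (R3) follows as soon as SOME
representative of the ground state has a cusp modulus with remainder
(`hasInteriorRegularDefect_of_ae_cuspModulusWith`), and the R6 criterion is stated in that
representative-correct form (`weilLogPohozaevAt_of_ae_cuspModulusWith`).

Sources: E. Bombieri, *Remarks on Weil's quadratic functional in the theory of prime numbers I*,
Rend. Mat. Acc. Lincei (9) 11 (2000) §4 Thm 3, Thm 5, §6 (the objects); the a.e. bookkeeping is
folklore.
-/

set_option linter.dupNamespace false

noncomputable section

open MeasureTheory Set Filter
open scoped Topology ENNReal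

namespace Summit.RiemannHypothesis.RiemannHypothesis.Theorems.PfPersistence

open Literature.NumberTheory.LFunctions
open Summit.RiemannHypothesis.RiemannHypothesis.Theorems.EvenWinsBeyondArch
open Summit.RiemannHypothesis.RiemannHypothesis.Theorems.WeilWindowFlowWindowLipschitz
open Summit.RiemannHypothesis.RiemannHypothesis.Theorems.WeilGroundStateMarkovPart

variable {a : ℝ} {u v : ℝ → ℂ}

/-! ## a.e. congruence of the dilation objects -/

/-- `ũ` only depends on the a.e. class. [folklore] -/
theorem weilTrunc_congr_ae (a : ℝ) (h : u =ᵐ[volume] v) :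
    weilTrunc a u =ᵐ[volume] weilTrunc a v := by
  filter_upwards [h] with x hx
  simp only [weilTrunc, indicator_apply, hx]

/-- `U_η f` only depends on the a.e. class of `f` (`η ≠ -1`). [folklore] -/
theorem weilDilate_congr_ae {η : ℝ} (hη : 1 + η ≠ 0) {f g : ℝ → ℂ} (h : f =ᵐ[volume] g) :
    weilDilate η f =ᵐ[volume] weilDilate η g := by
  -- the dilation `x ↦ (1+η)x` is quasi-measure-preserving (`Real.map_volume_mul_left`)
  have hq : Measure.QuasiMeasurePreserving (fun x : ℝ ↦ (1 + η) * x) volume volume := by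
    refine ⟨measurable_const_mul _, ?_⟩
    rw [Real.map_volume_mul_left hη]
    exact Measure.smul_absolutelyContinuous
  have hc := hq.ae_eq_comp h
  filter_upwards [hc] with x hx
  have hx' : f ((1 + η) * x) = g ((1 + η) * x) := hx
  simp only [weilDilate_apply, hx']

/-- The boundary layer `σ_h` only depends on the a.e. class. [folklore] -/
theorem weilEdgeLayer_congr_ae (a h : ℝ) (huv : u =ᵐ[volume] v) :
    weilEdgeLayer a u h =ᵐ[volume] weilEdgeLayer a v h := by
  filter_upwards [weilTrunc_congr_ae a huv] with x hx
  simp only [weilEdgeLayer, indicator_apply, hx]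

/-- The dilation defect `w_η` only depends on the a.e. class (`η ≠ -1`). [folklore] -/
theorem weilDilationDefect_congr_ae (a : ℝ) {η : ℝ} (hη : 1 + η ≠ 0) (huv : u =ᵐ[volume] v) :
    weilDilationDefect a u η =ᵐ[volume] weilDilationDefect a v η := by
  filter_upwards [weilTrunc_congr_ae a huv, weilDilate_congr_ae hη (weilTrunc_congr_ae a huv)]
    with x h1 h2
  simp only [weilDilationDefect, Pi.sub_apply, h1, h2]

/-- The interior dilation defect `t_η` only depends on the a.e. class (`η ≠ -1`). [folklore] -/
theorem weilInteriorDefect_congr_ae (a : ℝ) {η : ℝ} (hη : 1 + η ≠ 0) (huv : u =ᵐ[volume] v) :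
    weilInteriorDefect a u η =ᵐ[volume] weilInteriorDefect a v η := by
  filter_upwards [weilDilationDefect_congr_ae a hη huv,
    weilEdgeLayer_congr_ae a (layerDepth a η) huv] with x h1 h2
  simp only [weilInteriorDefect, Pi.add_apply, h1, h2]

/-! ## a.e. congruence of the forms -/

/-- The pole form `P(f)` only depends on the a.e. class. [folklore] -/
theorem weilPoleForm_congr_ae {f g : ℝ → ℂ} (h : f =ᵐ[volume] g) :
    weilPoleForm f = weilPoleForm g := by
  have h1 : ∫ t : ℝ, f t * (Real.cosh (t / 2) : ℂ) = ∫ t : ℝ, g t * (Real.cosh (t / 2) : ℂ) := by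
    refine integral_congr_ae ?_
    filter_upwards [h] with t ht
    simp only [ht]
  have h2 : ∫ t : ℝ, f t * (Real.sinh (t / 2) : ℂ) = ∫ t : ℝ, g t * (Real.sinh (t / 2) : ℂ) := by
    refine integral_congr_ae ?_
    filter_upwards [h] with t ht
    simp only [ht]
  simp only [weilPoleForm, h1, h2]

/-- The window defect form `D_a(f)` only depends on the a.e. class. [folklore] -/
theorem windowDefectForm_congr_ae (a : ℝ) {f g : ℝ → ℂ} (h : f =ᵐ[volume] g) :
    windowDefectForm a f = windowDefectForm a g := by
  have hm : ∫ x, ‖f x‖ ^ 2 = ∫ x, ‖g x‖ ^ 2 := by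
    refine integral_congr_ae ?_
    filter_upwards [h] with x hx
    simp only [hx]
  simp only [windowDefectForm, weilPoleForm_congr_ae h, weilDirichletEnergy_congr_ae a h, hm]

/-- **(R3) is a property of the a.e. class.** [folklore] -/
theorem HasInteriorRegularDefect.congr_ae (h : HasInteriorRegularDefect a u)
    (huv : u =ᵐ[volume] v) : HasInteriorRegularDefect a v := by
  unfold HasInteriorRegularDefect at h ⊢
  refine h.congr' ?_
  filter_upwards [self_mem_nhdsWithin] with η hη
  rw [mem_Ioi] at hη
  rw [windowDefectForm_congr_ae a (weilInteriorDefect_congr_ae a (by linarith) huv)]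

/-- (R3) for `u` iff (R3) for any a.e.-equal `v`. [folklore] -/
theorem hasInteriorRegularDefect_congr_ae (huv : u =ᵐ[volume] v) :
    HasInteriorRegularDefect a u ↔ HasInteriorRegularDefect a v :=
  ⟨fun h ↦ h.congr_ae huv, fun h ↦ h.congr_ae huv.symm⟩

/-! ## The representative form of the cusp-modulus criterion -/

/-- **(R3) from a cusp modulus with remainder of SOME representative.** If a Weil ground state
`u` has an a.e.-representative `v` with `HasCuspModulusWith a v C Ξ`, `IsCuspRemainder Ξ ω`,
then `D_a(t_η(u))/η → 0`. [cite: Bombieri2000Weil, §4 Thm 5, §6] -/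
theorem hasInteriorRegularDefect_of_ae_cuspModulusWith (hu : IsWeilGroundState a u)
    (hvu : v =ᵐ[volume] u) {C : ℝ} {Ξ ω : ℝ → ℝ} (hC : HasCuspModulusWith a v C Ξ)
    (hR : IsCuspRemainder Ξ ω) : HasInteriorRegularDefect a u :=
  (hasInteriorRegularDefect_of_cuspModulusWith (hu.congr_ae hvu.symm) hC hR).congr_ae hvu

/-- **The representative-correct R6 criterion (R3″ ⇒ R6 at differentiability windows).** If
every ground state of the window `a` has an a.e.-representative admitting a cusp modulus with
remainder, and `ε` is differentiable at `a`, then `WeilLogPohozaevAt a`.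
[cite: Bombieri2000Weil, §4 Thm 3] -/
theorem weilLogPohozaevAt_of_ae_cuspModulusWith
    (hmod : ∀ u : ℝ → ℂ, IsWeilGroundState a u → ∃ v : ℝ → ℂ, v =ᵐ[volume] u ∧
      ∃ C : ℝ, ∃ Ξ ω : ℝ → ℝ, HasCuspModulusWith a v C Ξ ∧ IsCuspRemainder Ξ ω)
    (hd : DifferentiableAt ℝ weilGroundEnergy a) : WeilLogPohozaevAt a :=
  weilLogPohozaevAt_of_interiorRegular
    (fun u hu ↦ by
      obtain ⟨v, hvu, C, Ξ, ω, hC, hR⟩ := hmod u hu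
      exact hasInteriorRegularDefect_of_ae_cuspModulusWith hu hvu hC hR) hd

/-- **Two-sided edge law from a representative's cusp modulus with remainder.** [folklore] -/
theorem deriv_weilGroundEnergy_eq_of_ae_cuspModulusWith (hu : IsWeilGroundState a u)
    (hvu : v =ᵐ[volume] u) {C : ℝ} {Ξ ω : ℝ → ℝ} (hC : HasCuspModulusWith a v C Ξ)
    (hR : IsCuspRemainder Ξ ω) (hd : DifferentiableAt ℝ weilGroundEnergy a) {V I : ℝ}
    (hV : HasDerivAt (weilDilationProfile a u) V 0) (hI : HasEdgeIntensity u a I) :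
    deriv weilGroundEnergy a = -(2 * edgeLawKernelConstant * I) :=
  deriv_weilGroundEnergy_eq_of_interiorRegular hu hd hV hI
    (hasInteriorRegularDefect_of_ae_cuspModulusWith hu hvu hC hR)

end Summit.RiemannHypothesis.RiemannHypothesis.Theorems.PfPersistence

end
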